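import Mathlib.Tactic
import HarnessLib

/-!
# Kozma–Nitzan's Question 8 at three relays — the v-ISLAND SLICE of the centring functional (T*), scalar skeleton

Support file (`--supports stmt-CriticalPhenomena-4575`, closed crux; independent mathematics on Kozma–Nitzan's Question 8,
arXiv:2401.12397 §5.5 p. 36), prover `prim-ineq-gen-6` (gen 16).  No definitions, no named facts, no sorries; standard axioms.
Memo `run/shared/lean/prim/prim-ineq-gen-6/FINDING-G16.md` §1–§2.  Companion of `…KnQuestion8KerSplit.lean` /
`…KnQuestion8ClaimMReduction.lean` (same `star` functional).

Setting (frame `Y = ∅`, `U = V(C_x ∪ C_o)`, `h` an increasing function of `U`): condition on v's ISLAND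
`L := C_v^{G − {x,o}}` (the open cluster of `v` in the graph with `x` and `o` deleted).  Given `L`, put `R := G − L`
(vertices of `L` deleted), `P := μ_R(o ↮ x)`, `α := P(some x–L edge open)`, `γ := P(some o–L edge open)`; the two attachment
bits of `L` are independent Bernoulli(`α`), Bernoulli(`γ`) and independent of the configuration on `R`, which is unconditioned
product measure.  Then `o ~ x ⟺ (o ~ x in R) ∨ (both bits)`, `U = U_R ∪ (L if some bit)`, `U_R := V(C_x ∪ C_o)` computed in `R`,
and the five atoms of the cell have slice masses `mPV = P·α(1−γ)`, `mPM = P·(1−α)(1−γ)`, `mE = P·(1−α)γ`,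
`π = mPV + mPM = P(1−γ)`, `a = 1 − P(1−αγ)`.  For an up-set `𝒜` of vertex sets write
`G1p := μ_R(U_R ∪ L ∈ 𝒜)`, `G0p := μ_R(U_R ∈ 𝒜)` (unconditional) and `G1 := μ_R(U_R ∪ L ∈ 𝒜 | o ↮ x)`, `G0 := μ_R(U_R ∈ 𝒜 | o ↮ x)`;
Harris in `R` (conditioning on the decreasing event `o ↮ x`) gives `G1 ≤ G1p`, `G0 ≤ G0p`, and monotonicity gives `G0 ≤ G1`.
The slice integrals are `gO = u·G1p + (1−u)·G0p − P·((f+g)·G1 + (1−u)·G0)` (`u = α+γ−αγ`, `f = α(1−γ)`, `g = (1−α)γ`),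
`gPV = P·f·G1`, `gPM = P·(1−u)·G0`, and the cell's centring functional is, as in `PocketCert.star_eq_kerSplit`,
  `star := mPM·(π·gO − a·gP) − mE·(mPM·gP − π·gPM)`,  `gP = gPV + gPM`.
* `PocketCert.star_islandSlice_eq` — the IDENTITY
    `star = P²(1−γ)(1−u)·[ u·(G1p − G1) + (1−u)·(G0p − G0) + (1−P)·g·(G1 − G0) ]`.
* `PocketCert.tstar_islandSlice` — hence `0 ≤ star` in every v-island slice (with that slice's own masses): (T*) holds
  conditionally on `C_v^{G−{x,o}} = L` for every `L`; in particular on every `K_{2,r}` (+ edge `xo`) multigraph ("mean-field (T*)").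
What is NOT proved here (memo §3): the mixture over `L` with the GLOBAL masses, i.e. (T*) itself; the memo reduces it to the
census-clean statement (★★) about the conditional laws `μ_{G−L}(· | o ↮ x)`.
[cite: KozmaNitzan2024, Question 8 (§5.5 p. 36)] [cite: VandenbergHaggstromKahn2005, Thm. 2.1 (p. 9)]
-/

namespace Summit.CriticalPhenomena.PercolationContinuityZ3.Theorems

namespace PocketCert

/-- **The v-island slice identity** for the centring functional `star` (pure ring identity; dictionary in the module
docstring): with slice masses and slice integrals expressed through `P, α, γ` and the four up-set probabilities
`G1p, G0p, G1, G0`, `star = P²(1−γ)(1−u)·[u(G1p−G1) + (1−u)(G0p−G0) + (1−P)g(G1−G0)]`.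
[cite: KozmaNitzan2024, Question 8 (§5.5 p. 36)] -/
theorem star_islandSlice_eq (P α γ G1p G0p G1 G0 : ℝ) :
    let u := α + γ - α * γ
    let f := α * (1 - γ)
    let g := (1 - α) * γ
    let mPM := P * (1 - u)
    let mE := P * g
    let π := P * (1 - γ)
    let a := 1 - P * (1 - α * γ)
    let gO := u * G1p + (1 - u) * G0p - P * ((f + g) * G1 + (1 - u) * G0)
    let gPV := P * f * G1
    let gPM := P * (1 - u) * G0
    mPM * (π * gO - a * (gPV + gPM)) - mE * (mPM * (gPV + gPM) - π * gPM) =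
      P ^ 2 * (1 - γ) * (1 - u) * (u * (G1p - G1) + (1 - u) * (G0p - G0) + (1 - P) * g * (G1 - G0)) := by
  intro u f g mPM mE π a gO gPV gPM
  simp only [u, f, g, mPM, mE, π, a, gO, gPV, gPM]
  ring

/-- **(T*) in every v-island slice** ("mean-field (T*)"): for `P, α, γ ∈ [0,1]` and up-set probabilities with
`G1 ≤ G1p`, `G0 ≤ G0p` (Harris in `R`) and `G0 ≤ G1` (monotonicity), the slice's centring functional is nonnegative.
[cite: KozmaNitzan2024, Question 8 (§5.5 p. 36)] [cite: VandenbergHaggstromKahn2005, Thm. 2.1 (p. 9)] -/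
theorem tstar_islandSlice (P α γ G1p G0p G1 G0 : ℝ)
    (hP0 : 0 ≤ P) (hP1 : P ≤ 1) (hα0 : 0 ≤ α) (hα1 : α ≤ 1) (hγ0 : 0 ≤ γ) (hγ1 : γ ≤ 1)
    (h1 : G1 ≤ G1p) (h0 : G0 ≤ G0p) (h10 : G0 ≤ G1) :
    let u := α + γ - α * γ
    let f := α * (1 - γ)
    let g := (1 - α) * γ
    let mPM := P * (1 - u)
    let mE := P * g
    let π := P * (1 - γ)
    let a := 1 - P * (1 - α * γ)
    let gO := u * G1p + (1 - u) * G0p - P * ((f + g) * G1 + (1 - u) * G0)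
    let gPV := P * f * G1
    let gPM := P * (1 - u) * G0
    0 ≤ mPM * (π * gO - a * (gPV + gPM)) - mE * (mPM * (gPV + gPM) - π * gPM) := by
  have key := star_islandSlice_eq P α γ G1p G0p G1 G0
  simp only at key ⊢
  rw [key]
  have hu0 : 0 ≤ α + γ - α * γ := by nlinarith
  have hu1 : 0 ≤ 1 - (α + γ - α * γ) := by nlinarith
  have hg : 0 ≤ (1 - α) * γ := mul_nonneg (by linarith) hγ0
  have hA : 0 ≤ (α + γ - α * γ) * (G1p - G1) := mul_nonneg hu0 (by linarith)
  have hB : 0 ≤ (1 - (α + γ - α * γ)) * (G0p - G0) := mul_nonneg hu1 (by linarith)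
  have hC : 0 ≤ (1 - P) * ((1 - α) * γ) * (G1 - G0) := mul_nonneg (mul_nonneg (by linarith) hg) (by linarith)
  have hD : 0 ≤ P ^ 2 * (1 - γ) * (1 - (α + γ - α * γ)) :=
    mul_nonneg (mul_nonneg (pow_nonneg hP0 2) (by linarith)) hu1
  exact mul_nonneg hD (by linarith)

end PocketCert

end Summit.CriticalPhenomena.PercolationContinuityZ3.Theorems
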